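import Literature.Probability.RandomPlanarGeometry.SLEOnePointNonSwallowingProofs
import Literature.Probability.RandomPlanarGeometry.CritPercSLELocalityMartingaleProofs
import Literature.Probability.RandomPlanarGeometry.SLETwoPointMartingaleProofs
import Literature.Probability.RandomPlanarGeometry.CritPercSLELocalityConverse
import Literature.Probability.RandomPlanarGeometry.SLETwoPointItoProofs
import Literature.Probability.RandomPlanarGeometry.SLEExistenceAt
import Literature.Probability.RandomPlanarGeometry.SLETransienceEntailsTrace
import Literature.Probability.RandomPlanarGeometry.SLETransienceKappaEightHolds
import HarnessLib

/-!
# `κ = 6` is the only SLE satisfying Cardy's formula: reduction to one Itô step and trace theorems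

Topic `Probability/RandomPlanarGeometry`; theorems only (third proof file of the named fact
`Literature.Probability.RandomPlanarGeometry.eq_six_of_forall_measureReal_hitsBefore`,
**crit-perc.S21**, after `CritPercSLELocalityProofs` and `CritPercSLELocalityMartingaleProofs`).
The cited source (Werner, *Lectures on two-dimensional critical percolation* (2007), Sect. 3 §2
"Hand-waving argument", p. 19 of arXiv:0710.0856) prints: "it is the conditional probability given
`γ[0,t]` of the event that the curve `γ` hits the arc `ca` on `∂D` before the arc `bc`. The
computation (this is "Cardy's formula computation for SLE" in Greg Lawler's course) shows that
SLE(6) is the only SLE with this property."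

`CritPercSLELocalityMartingaleProofs` reduced the target to three inputs: the martingale property
of Lawler's two-point observable for `κ > 4` (`hS`, the Itô step of Lawler (2005), Prop. 6.33),
"positive reals are not a.s. swallowed for `κ ≤ 4`" (`h₃`, Lawler (2005), Prop. 6.8, first
assertion) and the existence of the chordal SLE_κ curve (`hex = exists_isSLECurve`). This file
records where the line now ends on both sides:

1. **Upper bound (what suffices).** `h₃` is now a theorem
   (`not_ae_sle_swallowingTime_lt_top_of_le_four` of `SLEOnePointNonSwallowingProofs`: Lawler's
   Prop. 6.8, first assertion, from the one-point Itô steps for `κ ≤ 4`, themselves discharged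
   there from the tree's Itô formula), and `hS` follows by `SLETwoPointMartingaleProofs` from the
   local-martingale property of the two-point observable. Hence the target follows from **one
   Itô-formula output and the existence of the SLE_κ curve**
   (`eq_six_of_forall_measureReal_hitsBefore_of_itoStep`), equivalently from that Itô step and the
   three trace theorems `hasSLETrace_eight` (Lawler–Schramm–Werner (2004), Thm. 4.7),
   `hasSLETrace_of_ne_eight` (Rohde–Schramm (2005), Thm. 5.1) and `tendsto_norm_sleTrace_atTop`
   (Rohde–Schramm (2005), Thm. 7.1) (`eq_six_of_forall_measureReal_hitsBefore_of_itoStep_of_traceTheorems`,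
   through `exists_isSLECurve_iff`); with the named fact `sle_martingale_twoPointObservable` in
   place of the Itô step, from that fact and `exists_isSLECurve` alone
   (`eq_six_of_forall_measureReal_hitsBefore_of_twoPointMartingale`). The rectangle-free core —
   Cardy's formula for the swallowing times of the SLE_κ Loewner chain in `ℍ` forces `κ = 6` —
   needs the single Itô step only (`eq_six_of_forall_eq_cardyFunction_of_itoStep`); this is the
   literal content of Werner's sentence ("Cardy's formula computation for SLE").
2. **Lower bound (what the named fact carries)** is `CritPercSLELocalityConverse`: because the
   fact quantifies over SLE_κ *laws on curve space* (`IsSLELaw`), it implies `HasSLETrace κ` and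
   a.s. transience of the trace for every `κ > 0`, `κ ≠ 6` (Rohde–Schramm Thm. 5.1 / 7.1,
   Lawler–Schramm–Werner Thm. 4.7 at `κ = 8`). So, on the trace side, the inputs of
   `eq_six_of_forall_measureReal_hitsBefore_of_itoStep_of_traceTheorems` are also necessary up to
   the single value `κ = 6`; the statement is faithful to the source but heavier than the printed
   computation, whose exact content is item 1's rectangle-free core.

3. **With the Itô step proved** (`sle_martingale_twoPointObservable_holds` of
   `SLETwoPointItoProofs`, Lawler's Prop. 6.33 martingale from the tree's Itô formula and product
   rule): the rectangle-free core is an unconditional theorem — *if the swallowing times of the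
   SLE_κ Loewner chain satisfy Cardy's formula on the line, then `κ = 6`*
   (`eq_six_of_forall_eq_cardyFunction_holds`), and the named fact follows from the existence of
   the chordal SLE_κ curve alone (`eq_six_of_forall_measureReal_hitsBefore_of_exists_isSLECurve`),
   i.e. from the three trace theorems (`eq_six_of_forall_measureReal_hitsBefore_of_traceTheorems`).
   Combined with item 2, the named fact now sits exactly between "all SLE_κ traces exist and are
   transient" and "all SLE_κ traces exist for `κ ≠ 6`": what remains of it is trace theory, not
   stochastic calculus.
4. **One `κ` at a time, the exact content.** Reading the existence of the SLE curve at a single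
   `κ` (`exists_isSLECurve_at` of `SLEExistenceAt`), the Carleson-triangle test and the half-plane
   core give the target *at `κ`* from an SLE_κ curve in every Dobrushin domain
   (`eq_six_of_forall_measureReal_hitsBefore_at`), and the named fact becomes an equivalence:
   `eq_six_of_forall_measureReal_hitsBefore ↔ ∀ κ > 0, κ ≠ 6 → HasSLETrace κ ∧` (a.s. transience
   of the SLE_κ trace) (`eq_six_of_forall_measureReal_hitsBefore_iff`). The right-hand side is
   Rohde–Schramm (2005), Thm. 5.1 and Thm. 7.1, for `κ ∉ {6, 8}`, and Lawler–Schramm–Werner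
   (2004), Thm. 4.7, with transience, at `κ = 8`.

5. **The single remaining input: transience off `κ = 6`.** In this library's encoding a.s.
   transience of `sleTrace κ` already forces the chain to be generated by a curve
   (`hasSLETrace_of_ae_tendsto_norm_sleTrace_atTop` of `SLETransienceEntailsTrace`: the junk trace
   is constant), so the equivalence of item 4 sharpens to
   `eq_six_of_forall_measureReal_hitsBefore ↔ ∀ κ > 0, κ ≠ 6 →` (a.s. `|γ(t)| → ∞`)
   (`eq_six_of_forall_measureReal_hitsBefore_iff_transient`), equivalently, by the zero-one law of
   `SLETransienceZeroOne`, `↔ ∀ κ > 0, κ ≠ 6 → HasSLETrace κ ∧ P{0 ∉ cl γ[1, ∞)} ≠ 0`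
   (`eq_six_of_forall_measureReal_hitsBefore_iff_measure_ne_zero`). Hence the named fact follows
   from the single named fact `tendsto_norm_sleTrace_atTop` (Rohde–Schramm (2005), Thm. 7.1 with
   the Update for `κ = 8`) (`eq_six_of_forall_measureReal_hitsBefore_of_tendsto_norm_sleTrace_atTop`),
   and — the form a route uses — *at one `κ`* from any SLE_κ random curve or law in any Dobrushin
   domain (`eq_six_of_isSLECurve_of_forall_measureReal_hitsBefore`,
   `eq_six_of_isSLELaw_of_forall_measureReal_hitsBefore`): a scaling limit identified as chordal
   SLE_κ and satisfying Cardy's formula in all conformal rectangles has `κ = 6`, with no trace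
   theorem assumed.
6. **After Cor. 3.5.** With Rohde–Schramm's Cor. 3.5 (`RohdeSchramm2005_cor35_holds`), Thm. 5.1
   (`hasSLETrace_of_ne_eight_holds`) and Thm. 7.1 for `κ ≠ 8`
   (`tendsto_norm_sleTrace_atTop_of_ne_eight`) theorems of the tree, the named fact holds *at every
   `κ ≠ 8` unconditionally* (`eq_six_of_forall_measureReal_hitsBefore_of_ne_eight`), and as a whole
   it is **equivalent to `hasSLETrace_eight`** (Lawler–Schramm–Werner (2004), Thm. 4.7: SLE₈ is
   generated by a curve) (`eq_six_of_forall_measureReal_hitsBefore_iff_hasSLETrace_eight`), hence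
   to `tendsto_norm_sleTrace_atTop` and to `exists_isSLECurve` (`SLETransienceEntailsTrace`,
   `SLETransienceKappaEightHolds`). Its
   discharge is `eq_six_of_forall_measureReal_hitsBefore_of_hasSLETrace_eight hasSLETrace_eight_holds`
   once [LSW] Thm. 4.7 lands.

## References

* W. Werner, *Lectures on two-dimensional critical percolation*, IAS/Park City (2007),
  arXiv:0710.0856, Sect. 3 §2 (p. 19).
* G. F. Lawler, *Conformally Invariant Processes in the Plane*, AMS Math. Surveys 114 (2005):
  §1.10 Prop. 1.21, §6.2 Prop. 6.8, §6.7 Prop. 6.33, §6.8.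
* S. Rohde, O. Schramm, *Basic properties of SLE*, Ann. of Math. 161 (2005), Thm. 5.1, Thm. 7.1.
* G. Lawler, O. Schramm, W. Werner, *Conformal invariance of planar loop-erased random walks and
  uniform spanning trees*, Ann. Probab. 32 (2004), Thm. 4.7.
-/

noncomputable section

open Set Filter Topology MeasureTheory
open UpperHalfPlane (upperHalfPlaneSet)
open scoped NNReal

namespace Literature.Probability.RandomPlanarGeometry

open Loewner

/-! ### Upper bound: the target from three Itô steps and the existence of the SLE curve -/

/-- **The half-plane core from one Itô step** (Werner (2007), Sect. 3 §2 p. 19: "Cardy's formula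
computation for SLE … shows that SLE(6) is the only SLE with this property"; Lawler (2005),
Prop. 6.33 and §6.8, Prop. 6.8): if `κ > 0`, Lawler's two-point observable `Ψ_{2/κ}(Z_{t∧σ})` is a
local martingale for `κ > 4` (`hIto`), and Cardy's formula holds for the swallowing times of the
SLE_κ Loewner chain on the line (for every `η ∈ (0, 1)` some real `u, v` on opposite sides of `0`
with `|v|/(|u|+|v|) = η` have `P{T_u < T_v} = F(η)`), then `κ = 6`. The `κ ≤ 4` half
(positive reals are not a.s. swallowed) is the theorem `not_ae_sle_swallowingTime_lt_top_of_le_four`.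
No conformal rectangle and no existence of the SLE trace is involved. [cite: Werner2007, §3 p. 19] -/
theorem eq_six_of_forall_eq_cardyFunction_of_itoStep
    (hIto : ∀ ⦃κ : ℝ≥0⦄, 4 < κ → ∀ ⦃x y : ℝ⦄, 0 < x → y < 0 →
      IsLocalMartingale (sleTwoPointObservable κ x y) brownianFiltration Process.preWienerMeasure)
    {κ : ℝ≥0} (hκ : 0 < κ)
    (hcardy : ∀ η ∈ Ioo (0 : ℝ) 1, ∃ u v : ℝ, (u < 0 ∧ 0 < v ∨ v < 0 ∧ 0 < u) ∧
      |v| / (|u| + |v|) = η ∧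
      Process.preWienerMeasure.real {ω | swallowingTime (sleDriving κ ω) u <
        swallowingTime (sleDriving κ ω) v} = cardyFunction η) :
    κ = 6 :=
  eq_six_of_forall_eq_cardyFunction (sle_martingale_twoPointObservable_of_isLocalMartingale hIto)
    not_ae_sle_swallowingTime_lt_top_of_le_four hκ hcardy

/-- **The locality characterisation from the two-point martingale and trace existence** (Werner
(2007), Sect. 3 §2 p. 19; Lawler (2005), Prop. 6.33, Prop. 6.8 / Prop. 1.21): the named fact
`eq_six_of_forall_measureReal_hitsBefore` follows from the two-point martingale
`sle_martingale_twoPointObservable` (`SLETwoPointMartingale`, the Itô step of Lawler's Prop. 6.33)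
and the existence of the chordal SLE_κ curve (`exists_isSLECurve`); the `κ ≤ 4` input of
`eq_six_of_forall_measureReal_hitsBefore_of_martingale_halfPlane` is the theorem
`not_ae_sle_swallowingTime_lt_top_of_le_four`. [cite: Werner2007, §3 p. 19] -/
theorem eq_six_of_forall_measureReal_hitsBefore_of_twoPointMartingale
    (hS : sle_martingale_twoPointObservable) (hex : exists_isSLECurve) :
    eq_six_of_forall_measureReal_hitsBefore :=
  eq_six_of_forall_measureReal_hitsBefore_of_martingale_halfPlane hS
    not_ae_sle_swallowingTime_lt_top_of_le_four hex

/-- **The locality characterisation from one Itô step and the existence of the SLE curve**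
(Werner (2007), Sect. 3 §2 p. 19): `eq_six_of_forall_measureReal_hitsBefore` follows from the
local-martingale property of Lawler's two-point observable for `κ > 4` (`hIto`, the Itô step of
Lawler (2005), Prop. 6.33) and `exists_isSLECurve` (`hex`, needed to make the hypothesis of the
target non-vacuous). Every other ingredient — the `κ ≤ 4` phase, optional stopping, the
Markov/limit arguments, boundary correspondence, Carleson's triangles, the special-function
comparison — is proved in `Literature`. [cite: Werner2007, §3 p. 19] -/
theorem eq_six_of_forall_measureReal_hitsBefore_of_itoStep
    (hIto : ∀ ⦃κ : ℝ≥0⦄, 4 < κ → ∀ ⦃x y : ℝ⦄, 0 < x → y < 0 →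
      IsLocalMartingale (sleTwoPointObservable κ x y) brownianFiltration Process.preWienerMeasure)
    (hex : exists_isSLECurve) : eq_six_of_forall_measureReal_hitsBefore :=
  eq_six_of_forall_measureReal_hitsBefore_of_twoPointMartingale
    (sle_martingale_twoPointObservable_of_isLocalMartingale hIto) hex

/-- **The locality characterisation from one Itô step and the three trace theorems**
(Werner (2007), Sect. 3 §2 p. 19): as `eq_six_of_forall_measureReal_hitsBefore_of_itoStep`, with
`exists_isSLECurve` supplied by `exists_isSLECurve_iff` from `hasSLETrace_eight`
(Lawler–Schramm–Werner (2004), Thm. 4.7), `hasSLETrace_of_ne_eight` (Rohde–Schramm (2005),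
Thm. 5.1) and `tendsto_norm_sleTrace_atTop` (Rohde–Schramm (2005), Thm. 7.1). This is the complete
list of literature inputs of the named fact as vendored; by `CritPercSLELocalityConverse` the
trace theorems are also consequences of it off `κ = 6`. [cite: Werner2007, §3 p. 19] -/
theorem eq_six_of_forall_measureReal_hitsBefore_of_itoStep_of_traceTheorems
    (hIto : ∀ ⦃κ : ℝ≥0⦄, 4 < κ → ∀ ⦃x y : ℝ⦄, 0 < x → y < 0 →
      IsLocalMartingale (sleTwoPointObservable κ x y) brownianFiltration Process.preWienerMeasure)
    (h8 : hasSLETrace_eight) (hne : hasSLETrace_of_ne_eight) (htr : tendsto_norm_sleTrace_atTop) :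
    eq_six_of_forall_measureReal_hitsBefore :=
  eq_six_of_forall_measureReal_hitsBefore_of_itoStep hIto (exists_isSLECurve_iff.2 ⟨h8, hne, htr⟩)

/-! ### With the Itô step proved: the target from trace existence alone -/

/-- **"SLE(6) is the only SLE satisfying Cardy's formula" — the half-plane statement, proved**
(Werner (2007), Sect. 3 §2 p. 19: "The computation (this is "Cardy's formula computation for SLE"
in Greg Lawler's course) shows that SLE(6) is the only SLE with this property"; Lawler (2005),
Prop. 6.33, §6.8, Prop. 6.8 / Prop. 1.21): if `κ > 0` and Cardy's formula holds for the
swallowing times of the SLE_κ Loewner chain on the line (for every `η ∈ (0, 1)` some real `u, v`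
on opposite sides of `0` with `|v|/(|u|+|v|) = η` have `P{T_u < T_v} = F(η)`), then `κ = 6`.
Unconditional: the two-point martingale is `sle_martingale_twoPointObservable_holds`
(`SLETwoPointItoProofs`) and the `κ ≤ 4` phase is `not_ae_sle_swallowingTime_lt_top_of_le_four`
(`SLEOnePointNonSwallowingProofs`). [cite: Werner2007, §3 p. 19] -/
theorem eq_six_of_forall_eq_cardyFunction_holds {κ : ℝ≥0} (hκ : 0 < κ)
    (hcardy : ∀ η ∈ Ioo (0 : ℝ) 1, ∃ u v : ℝ, (u < 0 ∧ 0 < v ∨ v < 0 ∧ 0 < u) ∧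
      |v| / (|u| + |v|) = η ∧
      Process.preWienerMeasure.real {ω | swallowingTime (sleDriving κ ω) u <
        swallowingTime (sleDriving κ ω) v} = cardyFunction η) :
    κ = 6 :=
  eq_six_of_forall_eq_cardyFunction sle_martingale_twoPointObservable_holds
    not_ae_sle_swallowingTime_lt_top_of_le_four hκ hcardy

/-- **The locality characterisation from the existence of the SLE curve alone** (Werner (2007),
Sect. 3 §2 p. 19): the named fact `eq_six_of_forall_measureReal_hitsBefore` (crit-perc.S21)
follows from `exists_isSLECurve` (the chordal SLE_κ path exists as a random curve for every
`κ > 0`; needed only to make the hypothesis of the target non-vacuous, cf.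
`CritPercSLELocalityConverse` for the converse). Every stochastic-calculus, conformal-mapping and
special-function ingredient is proved in `Literature`. [cite: Werner2007, §3 p. 19] -/
theorem eq_six_of_forall_measureReal_hitsBefore_of_exists_isSLECurve (hex : exists_isSLECurve) :
    eq_six_of_forall_measureReal_hitsBefore :=
  eq_six_of_forall_measureReal_hitsBefore_of_twoPointMartingale
    sle_martingale_twoPointObservable_holds hex

/-- **The locality characterisation from the three trace theorems** (Werner (2007), Sect. 3 §2
p. 19): `eq_six_of_forall_measureReal_hitsBefore` follows from `hasSLETrace_eight`
(Lawler–Schramm–Werner (2004), Thm. 4.7), `hasSLETrace_of_ne_eight` (Rohde–Schramm (2005),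
Thm. 5.1) and `tendsto_norm_sleTrace_atTop` (Rohde–Schramm (2005), Thm. 7.1) — the complete list
of remaining literature inputs of the named fact. [cite: Werner2007, §3 p. 19] -/
theorem eq_six_of_forall_measureReal_hitsBefore_of_traceTheorems (h8 : hasSLETrace_eight)
    (hne : hasSLETrace_of_ne_eight) (htr : tendsto_norm_sleTrace_atTop) :
    eq_six_of_forall_measureReal_hitsBefore :=
  eq_six_of_forall_measureReal_hitsBefore_of_exists_isSLECurve
    (exists_isSLECurve_iff.2 ⟨h8, hne, htr⟩)

/-- **Where the named fact now sits**: it is implied by "every chordal SLE_κ trace exists and is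
transient" (`exists_isSLECurve`, equivalently `∀ κ > 0, HasSLETrace κ` plus
`tendsto_norm_sleTrace_atTop`, `exists_isSLECurve_iff_forall_hasSLETrace`) and implies "every
chordal SLE_κ trace exists for `κ ≠ 6`" (`CritPercSLELocalityConverse`). [cite: Werner2007, §3 p. 19] -/
theorem eq_six_of_forall_measureReal_hitsBefore_sandwich :
    (exists_isSLECurve → eq_six_of_forall_measureReal_hitsBefore) ∧
      (eq_six_of_forall_measureReal_hitsBefore → ∀ κ : ℝ≥0, 0 < κ → κ ≠ 6 → HasSLETrace κ) :=
  ⟨eq_six_of_forall_measureReal_hitsBefore_of_exists_isSLECurve,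
    fun h _ hκ hne ↦ hasSLETrace_of_eq_six_of_forall_measureReal_hitsBefore h hκ hne⟩

/-! ### One `κ` at a time: the exact trace-theoretic content of the named fact -/

/-- **Carleson's triangle test at one `κ`**: if SLE_κ random curves exist in every Dobrushin
domain, then for every `s ∈ (0, 1)` there is an SLE_κ law in a conformal rectangle (the marked
equilateral triangle `(Δ; 1, ζ, 0, s)`) with a uniformizing datum of Cardy value `s`
(`exists_isSLELaw_cardyFunction_crossRatio_eq` of `CritPercSLELocalityProofs`, read at `κ`).
[cite: Werner2007, §3 p. 19] -/
theorem exists_isSLELaw_cardyFunction_crossRatio_eq_at {κ : ℝ≥0}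
    (hexκ : ∀ D : DobrushinDomain, ∃ Γ, IsSLECurve κ D Γ) {s : ℝ} (hs : s ∈ Ioo (0 : ℝ) 1) :
    ∃ (R : ConformalRectangle) (μ : Measure (CurveClass ℂ))
      (φ : ConformalEquiv upperHalfPlaneSet R.carrier) (x : Fin 4 → ℝ),
      IsSLELaw κ (R.chord 0 2 (by decide)) μ ∧ R.IsUniformizing φ x ∧
        Literature.Probability.RandomPlanarGeometry.cardyFunction (crossRatio x) = s := by
  obtain ⟨Γ, hΓ⟩ := hexκ
    ((triangleRectangle 1 equilateralApex 0 affineIndependent_refTriangle s hs).chord 0 2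
      (by decide))
  obtain ⟨φ, x, hφ⟩ := MarkedDomain.exists_isUniformizing_holds
    (triangleRectangle 1 equilateralApex 0 affineIndependent_refTriangle s hs)
  exact ⟨_, _, φ, x, hΓ.isSLELaw_map, hφ,
    RandomPlanarGeometry.cardyFunction_crossRatio_refTriangle hs hφ⟩

/-- **From Cardy's formula in rectangles to Cardy's formula on the line, at one `κ`**
(`forall_eq_cardyFunction_of_forall_measureReal_hitsBefore` of
`CritPercSLELocalityMartingaleProofs`, read at `κ`): if SLE_κ random curves exist in every
Dobrushin domain and the SLE_κ laws satisfy Cardy's formula in every conformal rectangle, then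
for every `η ∈ (0, 1)` some real `u, v` on opposite sides of `0` with `|v|/(|u|+|v|) = η` have
`P{T_u < T_v} = F(η)`. [cite: Werner2007, §3 p. 19] -/
theorem forall_eq_cardyFunction_of_forall_measureReal_hitsBefore_at {κ : ℝ≥0}
    (hexκ : ∀ D : DobrushinDomain, ∃ Γ, IsSLECurve κ D Γ)
    (h : ∀ (R : ConformalRectangle) (μ : Measure (CurveClass ℂ))
      (φ : ConformalEquiv upperHalfPlaneSet R.carrier) (x : Fin 4 → ℝ),
      IsSLELaw κ (R.chord 0 2 (by decide)) μ → R.IsUniformizing φ x →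
        μ.real (CurveClass.hitsBefore (R.arc 2) (R.arc 1)) =
          Percolation.cardyFunction (crossRatio x)) :
    ∀ η ∈ Ioo (0 : ℝ) 1, ∃ u v : ℝ, (u < 0 ∧ 0 < v ∨ v < 0 ∧ 0 < u) ∧
      |v| / (|u| + |v|) = η ∧
      Process.preWienerMeasure.real {ω | swallowingTime (sleDriving κ ω) u <
        swallowingTime (sleDriving κ ω) v} =
        Literature.Probability.RandomPlanarGeometry.cardyFunction η := by
  intro η hη
  have hC : JordanDomain.exists_continuousOn_extension :=
    JordanDomain.exists_continuousOn_extension_holds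
  have hmono : StrictMonoOn Literature.Probability.RandomPlanarGeometry.cardyFunction (Icc 0 1) :=
    Literature.Probability.RandomPlanarGeometry.strictMonoOn_cardyFunction_holds
  have hη' : η ∈ Icc (0 : ℝ) 1 := ⟨hη.1.le, hη.2.le⟩
  have hs : Literature.Probability.RandomPlanarGeometry.cardyFunction η ∈ Ioo (0 : ℝ) 1 := by
    constructor
    · have := hmono (left_mem_Icc.2 zero_le_one) hη' hη.1
      rwa [Literature.Probability.RandomPlanarGeometry.cardyFunction_zero] at this
    · have := hmono hη' (right_mem_Icc.2 zero_le_one) hη.2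
      rwa [Literature.Probability.RandomPlanarGeometry.cardyFunction_one_holds] at this
  obtain ⟨R, μ, φ, x, hμ, hφ, hF⟩ := exists_isSLELaw_cardyFunction_crossRatio_eq_at hexκ hs
  obtain ⟨u, v, huv, hcr, hP⟩ := RandomPlanarGeometry.exists_measureReal_hitsBefore_eq hC R hμ
  have hx : crossRatio x ∈ Ioo (0 : ℝ) 1 :=
    ConformalRectangle.crossRatio_mem_Ioo_of_isUniformizing hφ
  have hηx : crossRatio x = η := hmono.injOn ⟨hx.1.le, hx.2.le⟩ hη' hF
  refine ⟨u, v, huv, ?_, ?_⟩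
  · rw [← hcr φ x hφ, hηx]
  · rw [← hP, h R μ φ x hμ hφ]
    exact congrArg Literature.Probability.RandomPlanarGeometry.cardyFunction hηx

/-- **The named fact at one `κ`, from the SLE_κ curves at that `κ`** (Werner (2007), Sect. 3 §2
p. 19): if `κ > 0`, SLE_κ random curves exist in every Dobrushin domain, and the SLE_κ laws satisfy
Cardy's formula in every conformal rectangle, then `κ = 6`. All other inputs — the two-point and
one-point martingales, the `κ ≤ 4` phase, boundary correspondence, Carleson's triangles, the
hypergeometric comparison — are theorems of `Literature`. [cite: Werner2007, §3 p. 19] -/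
theorem eq_six_of_forall_measureReal_hitsBefore_at {κ : ℝ≥0} (hκ : 0 < κ)
    (hexκ : ∀ D : DobrushinDomain, ∃ Γ, IsSLECurve κ D Γ)
    (h : ∀ (R : ConformalRectangle) (μ : Measure (CurveClass ℂ))
      (φ : ConformalEquiv upperHalfPlaneSet R.carrier) (x : Fin 4 → ℝ),
      IsSLELaw κ (R.chord 0 2 (by decide)) μ → R.IsUniformizing φ x →
        μ.real (CurveClass.hitsBefore (R.arc 2) (R.arc 1)) =
          Percolation.cardyFunction (crossRatio x)) :
    κ = 6 :=
  eq_six_of_forall_eq_cardyFunction_holds hκ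
    (forall_eq_cardyFunction_of_forall_measureReal_hitsBefore_at hexκ h)

/-- **The named fact at one `κ`, from the two trace theorems at that `κ`**: if `κ > 0`, SLE_κ is
generated by a curve (`HasSLETrace κ`: Rohde–Schramm (2005), Thm. 5.1 for `κ ≠ 8`,
Lawler–Schramm–Werner (2004), Thm. 4.7 for `κ = 8`) whose trace is a.s. transient (Rohde–Schramm
(2005), Thm. 7.1), and the SLE_κ laws satisfy Cardy's formula in every conformal rectangle, then
`κ = 6` (`exists_isSLECurve_at` of `SLEExistenceAt`). [cite: Werner2007, §3 p. 19] -/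
theorem eq_six_of_forall_measureReal_hitsBefore_of_hasSLETrace_at {κ : ℝ≥0} (hκ : 0 < κ)
    (hκt : HasSLETrace κ)
    (htr : ∀ᵐ ω ∂Process.preWienerMeasure, Tendsto (fun t ↦ ‖sleTrace κ ω t‖) atTop atTop)
    (h : ∀ (R : ConformalRectangle) (μ : Measure (CurveClass ℂ))
      (φ : ConformalEquiv upperHalfPlaneSet R.carrier) (x : Fin 4 → ℝ),
      IsSLELaw κ (R.chord 0 2 (by decide)) μ → R.IsUniformizing φ x →
        μ.real (CurveClass.hitsBefore (R.arc 2) (R.arc 1)) =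
          Percolation.cardyFunction (crossRatio x)) :
    κ = 6 :=
  eq_six_of_forall_measureReal_hitsBefore_at hκ (exists_isSLECurve_at hκt htr) h

/-- **The exact content of the named fact** (Werner (2007), Sect. 3 §2 p. 19, with Rohde–Schramm
(2005), Thm. 5.1 / 7.1, and Lawler–Schramm–Werner (2004), Thm. 4.7, for the existence side):
`eq_six_of_forall_measureReal_hitsBefore` holds **if and only if** for every `κ > 0`, `κ ≠ 6`,
SLE_κ is generated by a curve and its trace is almost surely transient. `←`:
`eq_six_of_forall_measureReal_hitsBefore_of_hasSLETrace_at` (at `κ = 6` the conclusion is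
trivial); `→`: an SLE_κ law in a rectangle witnesses both (`CritPercSLELocalityConverse`). Every
stochastic-calculus, conformal-mapping and special-function ingredient of Werner's sentence is
thus proved; what the vendored statement carries beyond it is precisely the SLE trace theory for
`κ ≠ 6`. [cite: Werner2007, §3 p. 19] -/
theorem eq_six_of_forall_measureReal_hitsBefore_iff :
    eq_six_of_forall_measureReal_hitsBefore ↔
      ∀ κ : ℝ≥0, 0 < κ → κ ≠ 6 → HasSLETrace κ ∧
        ∀ᵐ ω ∂Process.preWienerMeasure, Tendsto (fun t ↦ ‖sleTrace κ ω t‖) atTop atTop := by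
  constructor
  · intro h κ hκ h6
    exact ⟨hasSLETrace_of_eq_six_of_forall_measureReal_hitsBefore h hκ h6,
      ae_tendsto_norm_sleTrace_atTop_of_eq_six_of_forall_measureReal_hitsBefore h hκ h6⟩
  · intro h κ hκ hC
    by_cases h6 : κ = 6
    · exact h6
    · obtain ⟨hκt, htr⟩ := h κ hκ h6
      exact eq_six_of_forall_measureReal_hitsBefore_of_hasSLETrace_at hκ hκt htr hC

/-- **The named fact from the trace theorems off `κ = 6`**: Rohde–Schramm (2005), Thm. 5.1
(`hasSLETrace_of_ne_eight`), Lawler–Schramm–Werner (2004), Thm. 4.7 (`hasSLETrace_eight`) and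
transience, Rohde–Schramm (2005), Thm. 7.1 (`tendsto_norm_sleTrace_atTop`), each used only at
the values `κ ≠ 6`. [cite: Werner2007, §3 p. 19] -/
theorem eq_six_of_forall_measureReal_hitsBefore_of_traceTheorems' (h8 : hasSLETrace_eight)
    (hne : hasSLETrace_of_ne_eight) (htr : tendsto_norm_sleTrace_atTop) :
    eq_six_of_forall_measureReal_hitsBefore :=
  eq_six_of_forall_measureReal_hitsBefore_iff.2 fun κ hκ _ ↦ ⟨hasSLETrace h8 hne κ, htr hκ⟩

/-! ### The single remaining input: transience of the SLE trace off `κ = 6` -/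

/-- **The named fact at one `κ`, from an SLE_κ random curve in one Dobrushin domain** (Werner
(2007), Sect. 3 §2 p. 19): if `κ > 0`, `Γ` is a chordal SLE_κ random curve in some Dobrushin domain
`D` (`IsSLECurve κ D Γ`), and the SLE_κ laws satisfy Cardy's formula in every conformal rectangle,
then `κ = 6`. The curve `Γ` witnesses generation by a curve and a.s. transience at `κ`
(`hasSLETrace_and_transient_of_isSLECurve`), which is all
`eq_six_of_forall_measureReal_hitsBefore_of_hasSLETrace_at` needs; no trace theorem is assumed.
This is the form in which a route uses the locality characterisation: a scaling limit identified as
chordal SLE_κ in one domain and satisfying Cardy's formula in all rectangles has `κ = 6`.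
[cite: Werner2007, §3 p. 19] -/
theorem eq_six_of_isSLECurve_of_forall_measureReal_hitsBefore {κ : ℝ≥0} (hκ : 0 < κ)
    {D : DobrushinDomain} {Γ : (ℝ≥0 → ℝ) → CurveClass ℂ} (hΓ : IsSLECurve κ D Γ)
    (h : ∀ (R : ConformalRectangle) (μ : Measure (CurveClass ℂ))
      (φ : ConformalEquiv upperHalfPlaneSet R.carrier) (x : Fin 4 → ℝ),
      IsSLELaw κ (R.chord 0 2 (by decide)) μ → R.IsUniformizing φ x →
        μ.real (CurveClass.hitsBefore (R.arc 2) (R.arc 1)) =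
          Percolation.cardyFunction (crossRatio x)) :
    κ = 6 :=
  eq_six_of_forall_measureReal_hitsBefore_of_hasSLETrace_at hκ
    (hasSLETrace_and_transient_of_isSLECurve hΓ).1 (hasSLETrace_and_transient_of_isSLECurve hΓ).2 h

/-- **The named fact at one `κ`, from an SLE_κ law in one Dobrushin domain** (Werner (2007),
Sect. 3 §2 p. 19): if `κ > 0`, `μ₀` is a chordal SLE_κ law in some Dobrushin domain `D`
(`IsSLELaw κ D μ₀`), and the SLE_κ laws satisfy Cardy's formula in every conformal rectangle, then
`κ = 6` (`eq_six_of_isSLECurve_of_forall_measureReal_hitsBefore` for a random curve with law `μ₀`).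
[cite: Werner2007, §3 p. 19] -/
theorem eq_six_of_isSLELaw_of_forall_measureReal_hitsBefore {κ : ℝ≥0} (hκ : 0 < κ)
    {D : DobrushinDomain} {μ₀ : Measure (CurveClass ℂ)} (hμ₀ : IsSLELaw κ D μ₀)
    (h : ∀ (R : ConformalRectangle) (μ : Measure (CurveClass ℂ))
      (φ : ConformalEquiv upperHalfPlaneSet R.carrier) (x : Fin 4 → ℝ),
      IsSLELaw κ (R.chord 0 2 (by decide)) μ → R.IsUniformizing φ x →
        μ.real (CurveClass.hitsBefore (R.arc 2) (R.arc 1)) =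
          Percolation.cardyFunction (crossRatio x)) :
    κ = 6 := by
  obtain ⟨Γ, hΓ, -⟩ := hμ₀
  exact eq_six_of_isSLECurve_of_forall_measureReal_hitsBefore hκ hΓ h

/-- **The named fact at one `κ`, from a.s. transience of the SLE_κ trace alone**: in this
library's encoding a.s. transience of `sleTrace κ` forces the Loewner chain to be a.s. generated by
a curve (`hasSLETrace_of_ae_tendsto_norm_sleTrace_atTop`: the junk trace is constant), so the
hypothesis `HasSLETrace κ` of `eq_six_of_forall_measureReal_hitsBefore_of_hasSLETrace_at` is
redundant. Rohde–Schramm (2005), Thm. 7.1 at `κ` is the only input. [cite: Werner2007, §3 p. 19] -/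
theorem eq_six_of_forall_measureReal_hitsBefore_of_transient_at {κ : ℝ≥0} (hκ : 0 < κ)
    (htr : ∀ᵐ ω ∂Process.preWienerMeasure, Tendsto (fun t ↦ ‖sleTrace κ ω t‖) atTop atTop)
    (h : ∀ (R : ConformalRectangle) (μ : Measure (CurveClass ℂ))
      (φ : ConformalEquiv upperHalfPlaneSet R.carrier) (x : Fin 4 → ℝ),
      IsSLELaw κ (R.chord 0 2 (by decide)) μ → R.IsUniformizing φ x →
        μ.real (CurveClass.hitsBefore (R.arc 2) (R.arc 1)) =
          Percolation.cardyFunction (crossRatio x)) :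
    κ = 6 :=
  eq_six_of_forall_measureReal_hitsBefore_of_hasSLETrace_at hκ
    (hasSLETrace_of_ae_tendsto_norm_sleTrace_atTop htr) htr h

/-- **The exact content of the named fact, sharpened: transience off `κ = 6`.**
`eq_six_of_forall_measureReal_hitsBefore` holds **if and only if** for every `κ > 0`, `κ ≠ 6`, the
SLE_κ trace is almost surely transient (`|γ(t)| → ∞`); generation by a curve, the other conjunct of
`eq_six_of_forall_measureReal_hitsBefore_iff`, is entailed
(`hasSLETrace_of_ae_tendsto_norm_sleTrace_atTop`). The right-hand side is Rohde–Schramm (2005),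
Thm. 7.1 (with the Update for `κ = 8`), at the values `κ ≠ 6`. [cite: Werner2007, §3 p. 19] -/
theorem eq_six_of_forall_measureReal_hitsBefore_iff_transient :
    eq_six_of_forall_measureReal_hitsBefore ↔
      ∀ κ : ℝ≥0, 0 < κ → κ ≠ 6 →
        ∀ᵐ ω ∂Process.preWienerMeasure, Tendsto (fun t ↦ ‖sleTrace κ ω t‖) atTop atTop := by
  rw [eq_six_of_forall_measureReal_hitsBefore_iff]
  exact forall_congr' fun κ ↦ forall_congr' fun _ ↦ forall_congr' fun _ ↦
    ⟨And.right, fun h ↦ ⟨hasSLETrace_of_ae_tendsto_norm_sleTrace_atTop h, h⟩⟩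

/-- **The exact content of the named fact, in positive-probability form**: the fact holds iff for
every `κ > 0`, `κ ≠ 6`, SLE_κ is a.s. generated by a curve and `0 ∉ cl γ[1, ∞)` with *positive*
probability — the zero-one law and the scaling step of the printed proof of Rohde–Schramm's
Thm. 7.1 (p. 911) supply the rest (`ae_tendsto_norm_sleTrace_atTop_iff` of
`SLETransienceEntailsTrace`, from `SLETransienceZeroOne`). What is left for each `κ ≠ 6` is thus
Rohde–Schramm's Thm. 5.1 (Lawler–Schramm–Werner's Thm. 4.7 at `κ = 8`) and a positive-probability
version of Lemma 7.2 (`κ ≤ 4`) or Lemma 7.3 (`κ > 4`). [cite: Werner2007, §3 p. 19] -/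
theorem eq_six_of_forall_measureReal_hitsBefore_iff_measure_ne_zero :
    eq_six_of_forall_measureReal_hitsBefore ↔
      ∀ κ : ℝ≥0, 0 < κ → κ ≠ 6 → HasSLETrace κ ∧
        Process.preWienerMeasure {ω | (0 : ℂ) ∉ closure (sleTrace κ ω '' Ici 1)} ≠ 0 := by
  rw [eq_six_of_forall_measureReal_hitsBefore_iff_transient]
  exact forall_congr' fun κ ↦ forall_congr' fun _ ↦ forall_congr' fun _ ↦
    ae_tendsto_norm_sleTrace_atTop_iff (κ := κ)

/-- **The named fact from the single named fact `tendsto_norm_sleTrace_atTop`** (Rohde–Schramm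
(2005), Thm. 7.1 with the Update for `κ = 8`), used only at the values `κ ≠ 6`: of the three trace
theorems of `eq_six_of_forall_measureReal_hitsBefore_of_traceTheorems` the first two are entailed
by the third in this encoding (`exists_isSLECurve_iff_tendsto_norm_sleTrace_atTop'`). This is the
one upstream literature input on which a discharge of the named fact now waits.
[cite: Werner2007, §3 p. 19] -/
theorem eq_six_of_forall_measureReal_hitsBefore_of_tendsto_norm_sleTrace_atTop
    (htr : tendsto_norm_sleTrace_atTop) : eq_six_of_forall_measureReal_hitsBefore :=
  eq_six_of_forall_measureReal_hitsBefore_iff_transient.2 fun _ hκ _ ↦ htr hκ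

/-- **Where the named fact now sits, sharp form**: `tendsto_norm_sleTrace_atTop` (transience for
all `κ > 0`) implies it, and it implies transience for all `κ > 0`, `κ ≠ 6`; the gap is the single
value `κ = 6`, where the conclusion `κ = 6` is free. [cite: Werner2007, §3 p. 19] -/
theorem eq_six_of_forall_measureReal_hitsBefore_sandwich' :
    (tendsto_norm_sleTrace_atTop → eq_six_of_forall_measureReal_hitsBefore) ∧
      (eq_six_of_forall_measureReal_hitsBefore → ∀ κ : ℝ≥0, 0 < κ → κ ≠ 6 →
        ∀ᵐ ω ∂Process.preWienerMeasure, Tendsto (fun t ↦ ‖sleTrace κ ω t‖) atTop atTop) :=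
  ⟨eq_six_of_forall_measureReal_hitsBefore_of_tendsto_norm_sleTrace_atTop,
    eq_six_of_forall_measureReal_hitsBefore_iff_transient.1⟩

/-! ### After Cor. 3.5: the named fact off `κ = 8` unconditionally, and `↔ hasSLETrace_eight`

Rohde–Schramm's Cor. 3.5 (`RohdeSchramm2005_cor35_holds`), Thm. 5.1 (`hasSLETrace_of_ne_eight_holds`)
and Thm. 7.1 for `κ ≠ 8` (`tendsto_norm_sleTrace_atTop_of_ne_eight`) are now theorems of the tree,
and `hasSLETrace_eight → tendsto_norm_sleTrace_atTop` (`SLETransienceKappaEightHolds`). Consequences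
for the named fact. -/

/-- **The named fact at every `κ ≠ 8`, unconditionally** (Werner (2007), Sect. 3 §2 p. 19): for
`κ > 0`, `κ ≠ 8`, if the chordal SLE_κ laws satisfy Cardy's crossing formula in every conformal
rectangle, then `κ = 6`. The existence side at such `κ` — SLE_κ is generated by a curve with a.s.
transient trace (Rohde–Schramm (2005), Thms. 5.1 and 7.1, from Cor. 3.5) — is the theorem
`tendsto_norm_sleTrace_atTop_of_ne_eight`; the uniqueness side is
`eq_six_of_forall_measureReal_hitsBefore_of_transient_at`. [cite: Werner2007, §3 p. 19] -/
theorem eq_six_of_forall_measureReal_hitsBefore_of_ne_eight {κ : ℝ≥0} (hκ : 0 < κ) (hκ8 : κ ≠ 8)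
    (h : ∀ (R : ConformalRectangle) (μ : Measure (CurveClass ℂ))
      (φ : ConformalEquiv upperHalfPlaneSet R.carrier) (x : Fin 4 → ℝ),
      IsSLELaw κ (R.chord 0 2 (by decide)) μ → R.IsUniformizing φ x →
        μ.real (CurveClass.hitsBefore (R.arc 2) (R.arc 1)) =
          Percolation.cardyFunction (crossRatio x)) :
    κ = 6 :=
  eq_six_of_forall_measureReal_hitsBefore_of_transient_at hκ
    (tendsto_norm_sleTrace_atTop_of_ne_eight hκ hκ8) h

/-- **The named fact from Lawler–Schramm–Werner's Thm. 4.7 alone**: if SLE₈ is generated by a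
curve (`hasSLETrace_eight`), then `eq_six_of_forall_measureReal_hitsBefore` holds — through
`tendsto_norm_sleTrace_atTop_of_hasSLETrace_eight` and
`eq_six_of_forall_measureReal_hitsBefore_of_tendsto_norm_sleTrace_atTop`. This is the one upstream
literature input on which the discharge of the named fact now waits. [cite: Werner2007, §3 p. 19] -/
theorem eq_six_of_forall_measureReal_hitsBefore_of_hasSLETrace_eight (h8e : hasSLETrace_eight) :
    eq_six_of_forall_measureReal_hitsBefore :=
  eq_six_of_forall_measureReal_hitsBefore_of_tendsto_norm_sleTrace_atTop
    (tendsto_norm_sleTrace_atTop_of_hasSLETrace_eight h8e)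

/-- **The exact remaining content of the named fact: `↔ hasSLETrace_eight`.** In this library's
encoding `eq_six_of_forall_measureReal_hitsBefore` holds **if and only if** SLE₈ is almost surely
generated by a curve (Lawler–Schramm–Werner (2004), Thm. 4.7): `→` because the Cardy hypothesis at
`κ = 8 ≠ 6` must fail, which requires an SLE₈ law, hence the SLE₈ trace
(`hasSLETrace_eight_of_eq_six_of_forall_measureReal_hitsBefore`); `←` is
`eq_six_of_forall_measureReal_hitsBefore_of_hasSLETrace_eight`. Every other ingredient — Werner's
drift computation (Lawler's Props. 6.8 and 6.33 with their Itô steps), boundary correspondence,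
Carleson's form of Cardy's formula, and Rohde–Schramm's Cor. 3.5 / Thm. 5.1 / Thm. 7.1 for
`κ ≠ 8` — is a theorem of the tree. [cite: Werner2007, §3 p. 19] -/
theorem eq_six_of_forall_measureReal_hitsBefore_iff_hasSLETrace_eight :
    eq_six_of_forall_measureReal_hitsBefore ↔ hasSLETrace_eight :=
  ⟨hasSLETrace_eight_of_eq_six_of_forall_measureReal_hitsBefore,
    eq_six_of_forall_measureReal_hitsBefore_of_hasSLETrace_eight⟩

/-- **Equivalently: `↔` the SLE₈ trace is almost surely transient** (Rohde–Schramm (2005), Thm. 7.1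
with the Update, at `κ = 8`: `tendsto_norm_sleTrace_atTop_of_hasSLETrace_eight`; conversely a.s.
transience forces the trace, `hasSLETrace_of_ae_tendsto_norm_sleTrace_atTop`).
[cite: Werner2007, §3 p. 19] -/
theorem eq_six_of_forall_measureReal_hitsBefore_iff_transient_eight :
    eq_six_of_forall_measureReal_hitsBefore ↔
      ∀ᵐ ω ∂Process.preWienerMeasure, Tendsto (fun t ↦ ‖sleTrace 8 ω t‖) atTop atTop :=
  eq_six_of_forall_measureReal_hitsBefore_iff_hasSLETrace_eight.trans
    ⟨fun h8e ↦ tendsto_norm_sleTrace_atTop_of_hasSLETrace_eight h8e (by norm_num),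
      hasSLETrace_of_ae_tendsto_norm_sleTrace_atTop⟩

/-- **Equivalently: `↔ tendsto_norm_sleTrace_atTop`** (Rohde–Schramm (2005), Thm. 7.1 with the
Update, all `κ > 0`): the sandwich `eq_six_of_forall_measureReal_hitsBefore_sandwich'` closes, the
missing value `κ = 6` of the transience statement being a theorem
(`tendsto_norm_sleTrace_atTop_of_ne_eight` at `6 ≠ 8`). [cite: Werner2007, §3 p. 19] -/
theorem eq_six_of_forall_measureReal_hitsBefore_iff_tendsto_norm_sleTrace_atTop :
    eq_six_of_forall_measureReal_hitsBefore ↔ tendsto_norm_sleTrace_atTop :=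
  ⟨fun h ↦ tendsto_norm_sleTrace_atTop_of_hasSLETrace_eight
      (hasSLETrace_eight_of_eq_six_of_forall_measureReal_hitsBefore h),
    eq_six_of_forall_measureReal_hitsBefore_of_tendsto_norm_sleTrace_atTop⟩

/-- **Equivalently: `↔ exists_isSLECurve`** (chordal SLE_κ curves exist in every Dobrushin domain
for every `κ > 0`; `tendsto_norm_sleTrace_atTop_iff_exists_isSLECurve`). The three named facts
`eq_six_of_forall_measureReal_hitsBefore`, `tendsto_norm_sleTrace_atTop`, `exists_isSLECurve` and
`hasSLETrace_eight` are pairwise equivalent theorems-to-be of the tree; one proof of [LSW] Thm. 4.7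
discharges all four. [cite: Werner2007, §3 p. 19] -/
theorem eq_six_of_forall_measureReal_hitsBefore_iff_exists_isSLECurve :
    eq_six_of_forall_measureReal_hitsBefore ↔ exists_isSLECurve :=
  eq_six_of_forall_measureReal_hitsBefore_iff_tendsto_norm_sleTrace_atTop.trans
    tendsto_norm_sleTrace_atTop_iff_exists_isSLECurve

end Literature.Probability.RandomPlanarGeometry
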